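import Literature.Algebra.Homology.LaurentCechExact
import HarnessLib

/-!
# Evaluating the Laurent Čech model in an algebra: the kernel submodule of a family of "sections"

Let `A` be a commutative ring, `𝕜` a commutative `A`-algebra (in the application the function field
`K(Z)` of an integral closed subscheme `Z ⊆ 𝐏^N_A`), `θ₀, …, θ_M` invertible elements of `𝕜` (the
rational functions `H_c(x/x_{j₀})` of the members of a cover by basic opens `D₊(H_c)`), and
`σ : J → 𝕜` finitely many elements (twisted global sections). With the notation of
`Literature/Algebra/Homology/LaurentCech` (`P = A[y₀, …, y_M]`, `L = A[y^{±1}]`, `ιK : P^J → L^J`,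
`loc`, `Kdeg`, `locDeg`, `cech`), this file provides:

* `LaurentCech.evalθ θ : L →ₐ[A] 𝕜`, `y^m ↦ θ^m` (Mathlib `AddMonoidAlgebra.lift`), with
  `evalθ_toL : evalθ (toL p) = aeval θ p`;
* `LaurentCech.evalVec θ σ : L^J →ₗ[A] 𝕜`, `v ↦ Σ_j σ_j · evalθ (v_j)` — `L`-semilinear
  (`evalVec_smul`);
* `LaurentCech.kerGraded e θ σ ⊆ P^J` — **the graded kernel**: `w` lies in it iff every homogeneous
  component of `ιK w` (for the grading shifted by `e`) is killed by `evalVec`; it is a `P`-submodule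
  (`KfilterDeg_smul_of_mem`) and graded (`isGraded_kerGraded`);
* the two halves of the exactness of `0 → (K_s)_0 → (P^J_s)_0 → (sections) → 0` in the middle:
  `evalVec_eq_zero_of_mem_locDeg_kerGraded` and `mem_locDeg_kerGraded_of_evalVec_eq_zero`.

Pure algebra, fully proved; no named facts. Used by `Motives/ProjLineBundleSerre` to compare the
Čech complex of a line bundle on `Z` with `cech e ⊤ 0 / cech e (kerGraded) 0` and deduce the
finiteness of its `H¹` from `SerreFiniteness.moduleFinite_homology_of_shortExact`.

## References

* R. Hartshorne, *Algebraic Geometry*, GTM 52 (1977): II Prop. 5.15, III Thm. 5.2 (the graded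
  module `Γ_*` and its Čech complex). [Hartshorne1977]
-/

noncomputable section

open AddMonoidAlgebra

universe u v

namespace Literature.Algebra.Homology

namespace LaurentCech

variable {A : Type u} [CommRing A] {M : ℕ} {𝕜 : Type v} [CommRing 𝕜] [Algebra A 𝕜]

/-! ### Evaluation `y ↦ θ` -/

section Eval

variable (θ : Fin (M + 1) → 𝕜) (hθ : ∀ c, IsUnit (θ c))

/-- The monomial `θ^m = ∏_c θ_c^{m_c}` for `m ∈ ℤ^{M+1}`, as a unit (through the units `θ_c`).
[folklore] -/
def θpowU (m : Expt M) : 𝕜ˣ := ∏ c, (hθ c).unit ^ (m c)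

/-- The monomial `θ^m ∈ 𝕜`. [folklore] -/
abbrev θpow (m : Expt M) : 𝕜 := (θpowU θ hθ m : 𝕜)

/-- `θ^0 = 1`. [folklore] -/
@[simp] theorem θpowU_zero : θpowU θ hθ 0 = 1 := by simp [θpowU]

/-- `θ^{m + m'} = θ^m θ^{m'}`. [folklore] -/
theorem θpowU_add (m m' : Expt M) : θpowU θ hθ (m + m') = θpowU θ hθ m * θpowU θ hθ m' := by
  simp only [θpowU, Pi.add_apply, zpow_add, Finset.prod_mul_distrib]

/-- `θ^m` is a unit. [folklore] -/
theorem isUnit_θpow (m : Expt M) : IsUnit (θpow θ hθ m) := Units.isUnit _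

/-- `θ^m` on a natural exponent vector is the honest product of powers. [folklore] -/
theorem θpow_castExp (m : Fin (M + 1) →₀ ℕ) : θpow θ hθ (castExp M m) = ∏ c, θ c ^ (m c) := by
  simp only [θpow, θpowU, castExp_apply, zpow_natCast, Units.coe_prod, Units.val_pow_eq_pow_val,
    IsUnit.unit_spec]

/-- `m ↦ θ^m` as a monoid homomorphism on `Multiplicative ℤ^{M+1}`. [folklore] -/
def θpowHom : Multiplicative (Expt M) →* 𝕜 where
  toFun m := θpow θ hθ m.toAdd
  map_one' := by simp [θpow]
  map_mul' m m' := by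
    change θpow θ hθ (m.toAdd + m'.toAdd) = _
    rw [θpow, θpowU_add, Units.val_mul]

/-- **Evaluation `L = A[y^{±1}] → 𝕜`, `y^m ↦ θ^m`**, an `A`-algebra homomorphism. [folklore] -/
def evalθ : L A M →ₐ[A] 𝕜 := AddMonoidAlgebra.lift A 𝕜 (Expt M) (θpowHom θ hθ)

/-- `evalθ` on a monomial. [folklore] -/
@[simp] theorem evalθ_single (m : Expt M) (a : A) :
    evalθ θ hθ (single m a) = a • θpow θ hθ m := by
  rw [evalθ, lift_single]; rfl

/-- `evalθ (x_s^N) = θ_s^N` is a unit. [folklore] -/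
theorem isUnit_evalθ_xs (s : Finset (Fin (M + 1))) (N : ℤ) : IsUnit (evalθ θ hθ (xs A s N)) := by
  rw [xs, evalθ_single, one_smul]; exact isUnit_θpow θ hθ _

/-- **`evalθ ∘ toL` is the polynomial evaluation `p ↦ p(θ)`.** [folklore] -/
theorem evalθ_toL (p : P A M) : evalθ θ hθ (toL A M p) = MvPolynomial.aeval θ p := by
  have h : ((evalθ θ hθ).comp (toL A M) : P A M →ₐ[A] 𝕜) = MvPolynomial.aeval θ := by
    apply MvPolynomial.algHom_ext
    intro c
    rw [AlgHom.comp_apply, toL_X, MvPolynomial.aeval_X, evalθ_single, one_smul, θpow, θpowU,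
      Finset.prod_eq_single c]
    · simp
    · intro b _ hb; simp [hb]
    · intro h; exact absurd (Finset.mem_univ c) h
  exact congrArg (fun φ : P A M →ₐ[A] 𝕜 => φ p) h

end Eval

/-! ### Evaluation of vectors and the graded kernel -/

section Vec

variable {J : Type} (e : J → ℤ) (θ : Fin (M + 1) → 𝕜) (hθ : ∀ c, IsUnit (θ c)) (σ : J → 𝕜)

/-- **`evalVec v = Σ_j σ_j · v_j(θ)`** for `v ∈ L^J` (`J` finite). [folklore] -/
def evalVec [Fintype J] : (J → L A M) →ₗ[A] 𝕜 :=
  ∑ j : J, (LinearMap.mulLeft A (σ j)) ∘ₗ (evalθ θ hθ).toLinearMap ∘ₗ LinearMap.proj j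

/-- `evalVec` unfolded. [folklore] -/
theorem evalVec_apply [Fintype J] (v : J → L A M) :
    evalVec θ hθ σ v = ∑ j, σ j * evalθ θ hθ (v j) := by
  simp [evalVec, LinearMap.sum_apply]

/-- **`evalVec` is `L`-semilinear**: `evalVec (l • v) = l(θ) · evalVec v`. [folklore] -/
theorem evalVec_smul [Fintype J] (l : L A M) (v : J → L A M) :
    evalVec θ hθ σ (l • v) = evalθ θ hθ l * evalVec θ hθ σ v := by
  simp only [evalVec_apply, Pi.smul_apply, smul_eq_mul, map_mul, Finset.mul_sum]
  refine Finset.sum_congr rfl fun j _ => by ring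

variable (A M) in
/-- **The graded kernel `K ⊆ P^J`**: `w ∈ K` iff every homogeneous component of `ιK w` is killed by
`evalVec` (the relations, in each degree, among the sections `σ_j θ^m`). [folklore] -/
def kerGraded [Fintype J] : Submodule (P A M) (J → P A M) where
  carrier := {w | ∀ dd : ℤ, evalVec θ hθ σ (KfilterDeg e dd (ιK A M J w)) = 0}
  zero_mem' dd := by simp
  add_mem' {w w'} hw hw' dd := by
    simp only [Set.mem_setOf_eq] at hw hw'
    rw [map_add, map_add, map_add, hw dd, hw' dd, add_zero]
  smul_mem' p w hw dd := by
    classical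
    simp only [Set.mem_setOf_eq] at hw ⊢
    -- decompose `w` into homogeneous components
    rw [ιK_smul, ← sum_projDeg e w, map_sum, Finset.smul_sum, map_sum, map_sum]
    refine Finset.sum_eq_zero fun d _ => ?_
    rw [ιK_projDeg, KfilterDeg_smul_of_mem e (toL A M p) (KfilterDeg_mem_Kdeg e d _),
      evalVec_smul, hw d, mul_zero]

/-- Membership in the graded kernel. [folklore] -/
theorem mem_kerGraded_iff [Fintype J] {w : J → P A M} :
    w ∈ kerGraded A M e θ hθ σ ↔ ∀ dd : ℤ, evalVec θ hθ σ (KfilterDeg e dd (ιK A M J w)) = 0 :=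
  Iff.rfl

/-- A homogeneous vector lies in the graded kernel iff it is killed by `evalVec`. [folklore] -/
theorem mem_kerGraded_of_mem_Kdeg [Fintype J] {w : J → P A M} {dd : ℤ}
    (hw : ιK A M J w ∈ Kdeg A M e dd) :
    w ∈ kerGraded A M e θ hθ σ ↔ evalVec θ hθ σ (ιK A M J w) = 0 := by
  rw [mem_kerGraded_iff]
  constructor
  · intro h
    have := h dd
    rwa [KfilterDeg_of_mem e hw] at this
  · intro h d
    by_cases hd : d = dd
    · subst hd; rwa [KfilterDeg_of_mem e hw]
    · rw [KfilterDeg_of_mem_ne e hw hd, map_zero]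

/-- **The graded kernel is a graded submodule.** [folklore] -/
theorem isGraded_kerGraded [Fintype J] : IsGraded e (kerGraded A M e θ hθ σ) := by
  intro dd w hw
  rw [mem_kerGraded_iff] at hw ⊢
  intro d
  rw [ιK_projDeg]
  by_cases hd : d = dd
  · subst hd
    rw [KfilterDeg_of_mem e (KfilterDeg_mem_Kdeg e d _)]
    exact hw d
  · rw [KfilterDeg_of_mem_ne e (KfilterDeg_mem_Kdeg e dd _) hd, map_zero]

/-- Elements of the graded kernel are killed by `evalVec`. [folklore] -/
theorem evalVec_ιK_eq_zero_of_mem_kerGraded [Fintype J] {w : J → P A M}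
    (hw : w ∈ kerGraded A M e θ hθ σ) : evalVec θ hθ σ (ιK A M J w) = 0 := by
  classical
  rw [← sum_projDeg e w, map_sum, map_sum]
  refine Finset.sum_eq_zero fun d _ => ?_
  rw [ιK_projDeg]
  exact hw d

/-- **`(K_s)_0 ⊆ ker evalVec`**: the localized degree-zero elements of the graded kernel are killed
(`θ_s` is invertible). [folklore] -/
theorem evalVec_eq_zero_of_mem_locDeg_kerGraded [Fintype J] {s : Finset (Fin (M + 1))} {dd : ℤ}
    {v : J → L A M} (hv : v ∈ locDeg e (kerGraded A M e θ hθ σ) s dd) : evalVec θ hθ σ v = 0 := by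
  obtain ⟨⟨N, k, hk, hNv⟩, -⟩ := hv
  have h1 : evalVec θ hθ σ (xs A s N • v) = 0 := by
    rw [hNv]; exact evalVec_ιK_eq_zero_of_mem_kerGraded e θ hθ σ hk
  rw [evalVec_smul] at h1
  exact (isUnit_evalθ_xs θ hθ s N).mul_right_eq_zero.1 h1

/-- **`ker evalVec ∩ (P^J_s)_{dd} ⊆ (K_s)_{dd}`**: a localized homogeneous vector killed by `evalVec`
comes from the graded kernel. [folklore] -/
theorem mem_locDeg_kerGraded_of_evalVec_eq_zero [Fintype J] {s : Finset (Fin (M + 1))} {dd : ℤ}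
    {v : J → L A M} (hv : v ∈ locDeg e (⊤ : Submodule (P A M) (J → P A M)) s dd)
    (h0 : evalVec θ hθ σ v = 0) : v ∈ locDeg e (kerGraded A M e θ hθ σ) s dd := by
  obtain ⟨⟨N, k, -, hNv⟩, hdeg⟩ := hv
  refine ⟨⟨N, k, ?_, hNv⟩, hdeg⟩
  -- `k` is homogeneous of degree `dd + N #s` and killed
  have hk : ιK A M J k ∈ Kdeg A M e (dd + N * s.card) := by
    rw [← hNv]; exact xs_smul_mem_Kdeg e hdeg s N
  rw [mem_kerGraded_of_mem_Kdeg e θ hθ σ hk, ← hNv, evalVec_smul, h0, mul_zero]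

end Vec

end LaurentCech

end Literature.Algebra.Homology

end
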